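import Summits.Ventures.HodgeRepro2.T5SU11ResolventMonotoneDecay

/-!
# The strict positivity of the resolvent on the class: `G^I_λ g < 0` on `(0, ∞)` for `g ≥ 0`, `g ≢ 0`

Row 504 proved `G^I_λ g ≤ 0` for a source `g ≥ 0`. Here the sign is STRICT at every `t > 0` as soon as `g(t₀) > 0` at
one point `t₀ > 0`: with `G^I_λ g = −χ_λ B^I − φ_λ A^I`, `B^I(t) = ∫_{(0,t]} φ_λ g sinh`, `A^I(t) = ∫_{(t,∞)} χ_λ g sinh`,

* `B^I(t) > 0` for `t > t₀` (`greenBI_pos`) and `A^I(t) > 0` for `t ≤ t₀` (`greenAI_pos`) — the non-negative continuous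
  integrand is positive on a one-sided window at `t₀` (`setIntegral_pos_of_pos_on_Ioo`);
* hence **`G^I_λ g(t) < 0` for every `t > 0`** (`greenSolI_neg`), and `G^I_λ g(t) > 0` for a source `g ≤ 0` with
  `g(t₀) < 0` (`greenSolI_pos`) — the strong maximum principle for `(L − μ)⁻¹` on the class, every `λ > 1`.

Nothing is claimed about (N).

Blind lane: Mathlib + the HodgeRepro2 prefix only; no sorry; axioms ⊆ {propext, Classical.choice,
Quot.sound}.
-/

namespace Summit.Ventures.HodgeRepro2.T5SU11ResolventStrictPositivity

open Filter Topology MeasureTheory intervalIntegral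
open Set (Ioi Ioc Ioo)
open T5SU11Cartan T5SU11SphericalFunction T5SU11SphericalBounds T5SU11SphericalDecay T5SU11RadialGreenImproper
  T5SU11RadialGreenImproperDecaySource T5SU11RadialGreenImproperStable T5SU11ResolventIdentityDecay
  T5SU11ResolventMonotoneDecay

/-- A set integral of a non-negative integrable function is positive as soon as the function is positive on an open
interval inside the set. -/
theorem setIntegral_pos_of_pos_on_Ioo {F : ℝ → ℝ} {S : Set ℝ} (hS : MeasurableSet S) (hI : IntegrableOn F S)
    (hnn : ∀ s ∈ S, 0 ≤ F s) {a b : ℝ} (hab : a < b) (hsub : Ioo a b ⊆ S) (hpos : ∀ s ∈ Ioo a b, 0 < F s) :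
    0 < ∫ s in S, F s := by
  have hIoo : IntegrableOn F (Ioo a b) := hI.mono_set hsub
  have hint : IntervalIntegrable F volume a b :=
    (intervalIntegrable_iff_integrableOn_Ioo_of_le hab.le).mpr hIoo
  calc (0 : ℝ) < ∫ s in a..b, F s := intervalIntegral_pos_of_pos_on hint hpos hab
    _ = ∫ s in Ioo a b, F s := by rw [integral_of_le hab.le, integral_Ioc_eq_integral_Ioo]
    _ ≤ ∫ s in S, F s := by
        refine setIntegral_mono_set hI ?_ (LE.le.eventuallyLE hsub)
        exact ae_restrict_of_forall_mem hS (fun s hs => hnn s hs)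

/-- A one-sided window of positivity: a function continuous on `(0, ∞)` and positive at `t₀ > 0` is positive on some
`(t₀ − δ, t₀ + δ)` with `0 < δ ≤ t₀/2`. -/
theorem exists_window_pos {F : ℝ → ℝ} (hF : ContinuousOn F (Ioi 0)) {t₀ : ℝ} (ht₀ : 0 < t₀) (hpos : 0 < F t₀) :
    ∃ δ : ℝ, 0 < δ ∧ δ ≤ t₀ / 2 ∧ ∀ s ∈ Ioo (t₀ - δ) (t₀ + δ), 0 < F s := by
  have hct : ContinuousAt F t₀ := hF.continuousAt (Ioi_mem_nhds ht₀)
  obtain ⟨δ₀, hδ₀, hδ₀F⟩ : ∃ δ₀ > 0, ∀ s, dist s t₀ < δ₀ → 0 < F s :=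
    Metric.eventually_nhds_iff.mp (hct.eventually (lt_mem_nhds hpos))
  refine ⟨min δ₀ (t₀ / 2), lt_min hδ₀ (by positivity), min_le_right _ _, fun s hs => ?_⟩
  refine hδ₀F s ?_
  rw [Real.dist_eq, abs_lt]
  have h1 : min δ₀ (t₀ / 2) ≤ δ₀ := min_le_left _ _
  constructor <;> linarith [hs.1, hs.2]

section measure

variable [MeasurableSpace Circle] [BorelSpace Circle]

variable {lam : ℝ} (hlam : 1 < lam) {g : ℝ → ℝ} (hg : ContinuousOn g (Ioi 0))
  {M : ℝ} (hM : ∀ s ∈ Ioc (0 : ℝ) 1, |g s| ≤ M) (hM0 : 0 ≤ M)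
  {ε C s₀ : ℝ} (hε : 2 - lam < ε) (hC : ∀ s, s₀ ≤ s → |g s| ≤ C * Real.exp (-ε * s))
  (hg0 : ∀ s, 0 < s → 0 ≤ g s) {t₀ : ℝ} (ht₀ : 0 < t₀) (hgt₀ : 0 < g t₀)

include hg hM hM0 hg0 ht₀ hgt₀ in
/-- **`B^I(t) > 0` for `t > t₀`** when `g ≥ 0` and `g(t₀) > 0`. -/
theorem greenBI_pos {t : ℝ} (ht : t₀ < t) : 0 < greenBI (fun t => sph lam (hyp t)) g t := by
  obtain ⟨δ, hδ, hδt, hwin⟩ := exists_window_pos hg ht₀ hgt₀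
  unfold greenBI
  refine setIntegral_pos_of_pos_on_Ioo measurableSet_Ioc (integrableOn_sph_mul_mul_sinh_Ioc hg hM hM0 lam t)
    (fun s hs => ?_) (a := t₀ - δ) (b := t₀) (by linarith) (fun s hs => ⟨by linarith [hs.1], by linarith [hs.2]⟩)
    (fun s hs => ?_)
  · have hs0 : 0 < s := hs.1
    exact mul_nonneg (mul_nonneg (sph_hyp_pos lam s).le (hg0 s hs0)) (Real.sinh_nonneg_iff.mpr (by linarith))
  · have hs0 : 0 < s := by linarith [hs.1]
    have hgs : 0 < g s := hwin s ⟨hs.1, by linarith [hs.2]⟩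
    exact mul_pos (mul_pos (sph_hyp_pos lam s) hgs) (Real.sinh_pos_iff.mpr (by linarith))

include hlam hg hM hM0 hε hC hg0 ht₀ hgt₀ in
/-- **`A^I(t) > 0` for `0 < t ≤ t₀`** when `g ≥ 0` and `g(t₀) > 0`. -/
theorem greenAI_pos {t : ℝ} (ht : 0 < t) (htt₀ : t ≤ t₀) : 0 < greenAI (sphDecay lam) g t := by
  obtain ⟨δ, hδ, _, hwin⟩ := exists_window_pos hg ht₀ hgt₀
  unfold greenAI
  refine setIntegral_pos_of_pos_on_Ioo measurableSet_Ioi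
    ((integrableOn_sphDecay_mul_mul_sinh hlam hg hM hM0 hε hC).mono_set (Set.Ioi_subset_Ioi ht.le))
    (fun s hs => ?_) (a := t₀) (b := t₀ + δ) (by linarith) (fun s hs => by show t < s; linarith [hs.1])
    (fun s hs => ?_)
  · have hs0 : 0 < s := lt_trans ht hs
    exact mul_nonneg (mul_nonneg (sphDecay_pos hlam hs0).le (hg0 s hs0)) (Real.sinh_nonneg_iff.mpr (by linarith))
  · have hs0 : 0 < s := by linarith [hs.1]
    have hgs : 0 < g s := hwin s ⟨by linarith [hs.1], hs.2⟩
    exact mul_pos (mul_pos (sphDecay_pos hlam hs0) hgs) (Real.sinh_pos_iff.mpr (by linarith))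

include hlam hg hM hM0 hε hC hg0 ht₀ hgt₀ in
/-- **THE STRICT POSITIVITY OF THE RESOLVENT**: `G^I_λ g(t) < 0` for every `t > 0` when `g ≥ 0` on `(0, ∞)` and
`g(t₀) > 0` at one point `t₀ > 0`. -/
theorem greenSolI_neg {t : ℝ} (ht : 0 < t) : greenSolI (fun t => sph lam (hyp t)) (sphDecay lam) g t < 0 := by
  unfold greenSolI
  have hχ : 0 < sphDecay lam t := sphDecay_pos hlam ht
  have hφ : 0 < sph lam (hyp t) := sph_hyp_pos lam t
  have hB0 : 0 ≤ greenBI (fun t => sph lam (hyp t)) g t := greenBI_nonneg (lam := lam) hg0 t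
  have hA0 : 0 ≤ greenAI (sphDecay lam) g t := greenAI_nonneg hlam hg0 ht.le
  rcases lt_or_ge t₀ t with h | h
  · have hB := greenBI_pos hg hM hM0 hg0 ht₀ hgt₀ (lam := lam) h
    nlinarith [mul_pos hχ hB, mul_nonneg hφ.le hA0]
  · have hA := greenAI_pos hlam hg hM hM0 hε hC hg0 ht₀ hgt₀ ht h
    nlinarith [mul_nonneg hχ.le hB0, mul_pos hφ hA]

end measure

section negative

variable [MeasurableSpace Circle] [BorelSpace Circle]

variable {lam : ℝ} (hlam : 1 < lam) {g : ℝ → ℝ} (hg : ContinuousOn g (Ioi 0))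
  {M : ℝ} (hM : ∀ s ∈ Ioc (0 : ℝ) 1, |g s| ≤ M) (hM0 : 0 ≤ M)
  {ε C s₀ : ℝ} (hε : 2 - lam < ε) (hC : ∀ s, s₀ ≤ s → |g s| ≤ C * Real.exp (-ε * s))

include hlam hg hM hM0 hε hC in
/-- **`G^I_λ g(t) > 0` for every `t > 0` when `g ≤ 0` on `(0, ∞)` and `g(t₀) < 0`** at one point `t₀ > 0`. -/
theorem greenSolI_pos (hg0 : ∀ s, 0 < s → g s ≤ 0) {t₀ : ℝ} (ht₀ : 0 < t₀) (hgt₀ : g t₀ < 0) {t : ℝ} (ht : 0 < t) :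
    0 < greenSolI (fun t => sph lam (hyp t)) (sphDecay lam) g t := by
  have hneg := greenSolI_neg hlam (g := fun s => -g s) (hg.neg) (M := M) (fun s hs => by
      simpa only [abs_neg] using hM s hs) hM0 hε (fun s hs => by simpa only [abs_neg] using hC s hs)
    (fun s hs => by simpa using hg0 s hs) ht₀ (by simpa using hgt₀) ht
  have e : greenSolI (fun t => sph lam (hyp t)) (sphDecay lam) (fun s => -g s) t
      = -greenSolI (fun t => sph lam (hyp t)) (sphDecay lam) g t := by
    unfold greenSolI greenBI greenAI
    simp only [mul_neg, neg_mul, MeasureTheory.integral_neg]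
    ring
  rw [e] at hneg
  linarith

end negative

end Summit.Ventures.HodgeRepro2.T5SU11ResolventStrictPositivity
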